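import Mathlib
import HarnessLib
import Summits.BirchSwinnertonDyer.BirchSwinnertonDyer.Theses.ManinLocalTwoThree
import Summits.BirchSwinnertonDyer.BirchSwinnertonDyer.Theorems.ManinLocalTwoThreeModularDegreeOfLatticeOptimal
import Summits.BirchSwinnertonDyer.Rank1Residual.ManinAdditive.NeronOmegaThreeFrickeTrace
import Summits.BirchSwinnertonDyer.Rank1Residual.ManinAdditive.NeronOmegaGhostDuality
import Literature.NumberTheory.EllipticCurves.ModularCurveNonempty

/-!
# C3 on the Česnavičius–Neururer–Saha range by GHOST DUALITY, with the transport stub discharged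

Lead p1 gen 13 (route `ManinLocalTwoThree`, crux item stmt-BirchSwinnertonDyer-22968 = C3 `ManinPrimeToThreeAtNine`).  The
planner-of-record's second C3 line `Cruxes/ManinPrimeToThreeAtNine/Lines/ghost_duality.lean` (imc g23; published, deliberately
unregistered) composes C3 from four stubs: E-imc-177 (THEOREM 29.M on paper, PROOFS-g23 §5.4: on the rational-singularity range
{`9 ∣ N`, `81 ∤ N`, `27 ∤ N` or some prime `≡ 2 mod 3` divides `N`}, `3 ∣ c` forces the reduced-component depth strictly below
`ord₃ deg φ`), E-imc-161 `NeronOmegaThree.RedDepthEqModularDegreeAtThree` (the open, E-blind law: that depth EQUALS `ord₃ deg φ` for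
optimal data), the transport stub «lattice-optimal ⟹ degree-minimal», and the residual (C3 verbatim off the range).

The transport stub is now the tree theorem `modularDegree_le_of_latticeOptimal` (p710128).  This file records the line's content
with that stub DISCHARGED, as sorry-free CONDITIONAL theorems:

* `not_three_dvd_maninConstant_of_redDefect_of_redDepth_of_latticeOptimal` — COROLLARY 29.N at conductor level WITHOUT the
  degree-minimality hypothesis: E-177 ∧ E-161 ⟹ `3 ∤ c` for every LATTICE-optimal datum on the range;
* `not_three_dvd_maninConstant_of_ghostDuality_of_range` — the same in the crux's currency (level `N`, modularity binder
  `exists_isNewformOf` giving `N = N_W` by `ModularParametrizationData.level_eq_conductorNorm_of_exists`);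
* `maninPrimeToThreeAtNine_of_ghostDuality` — the route declaration `ManinPrimeToThreeAtNine` from E-177, E-161 and the residual
  statement alone (imc's kernel-checked composition with `hdeg` replaced by the theorem).

E-177 enters INLINE (its `@[conjecture]` name `NeronOmegaGenusG23.ThreeDvdManinForcesRedDefectAtThree` is typer ask T-imc-35, not
yet in the tree); E-161 enters BY NAME.  HONEST FRAMING: CONDITIONAL on E-177 (a cell theorem on paper, audit R-imc-70 pending) and on
the OPEN law E-161; nothing here proves C3, Manin's conjecture at `3`, or BSD.  The LEAD keeps `kato_shift_three` v18 as the C3 skeleton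
of record; this road is the documented two-node alternative on the range.  beyond-print theorem: NO.  bears_on: stmt-BirchSwinnertonDyer-22968.
-/

set_option linter.dupNamespace false
set_option autoImplicit false

noncomputable section

open scoped MatrixGroups ModularForm
open CongruenceSubgroup Literature.NumberTheory.EllipticCurves.ModularForms
  Summit.BirchSwinnertonDyer.Rank1Residual.ManinAdditive
  Summit.BirchSwinnertonDyer.Rank1Residual.ManinAdditive.NeronOmegaThree

namespace Summit.BirchSwinnertonDyer.BirchSwinnertonDyer.Theorems.ManinLocalTwoThree

/-- **COROLLARY 29.N without the degree hypothesis.**  E-imc-177 (inline: `3 ∣ c` forces `ord₃ [e_f L_red : ℤ f] < ord₃ deg φ` on the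
range) and E-imc-161 (`RedDepthEqModularDegreeAtThree`: `ord₃ [e_f L_red : ℤ f] = ord₃ deg φ` for optimal data) give `3 ∤ c` for every
LATTICE-optimal datum of conductor level with `9 ∣ N`, `81 ∤ N` on the rational-singularity range — the degree-minimality input of
E-161 is supplied by `forall_modularDegree_le_of_latticeOptimal` (p710128).  CONDITIONAL on E-177 and E-161. -/
theorem not_three_dvd_maninConstant_of_redDefect_of_redDepth_of_latticeOptimal
    (h177 : ∀ (W : WeierstrassCurve ℚ) [W.IsElliptic] [W.IsGloballyMinimal] [NeZero (W.conductorNorm ℤ)]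
      (D : ModularParametrizationData W (W.conductorNorm ℤ)),
      (∀ z ∈ D.L.lattice, ∃ w ∈ periodLattice D.f, z = D.c * w) →
      9 ∣ W.conductorNorm ℤ → ¬ 81 ∣ W.conductorNorm ℤ →
      (¬ 27 ∣ W.conductorNorm ℤ ∨ ∃ p : ℕ, p.Prime ∧ p ∣ W.conductorNorm ℤ ∧ p % 3 = 2) →
      (3 : ℤ) ∣ D.maninConstant →
        padicValNat 3 (lineIndex (drLatticeAtThree (W.conductorNorm ℤ)) D.f) < padicValNat 3 D.modularDegree)
    (h161 : RedDepthEqModularDegreeAtThree)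
    (W : WeierstrassCurve ℚ) [W.IsElliptic] [W.IsGloballyMinimal] [NeZero (W.conductorNorm ℤ)]
    (D : ModularParametrizationData W (W.conductorNorm ℤ))
    (hL : ∀ z ∈ D.L.lattice, ∃ w ∈ periodLattice D.f, z = D.c * w)
    (h9 : 9 ∣ W.conductorNorm ℤ) (h81 : ¬ 81 ∣ W.conductorNorm ℤ)
    (hrs : ¬ 27 ∣ W.conductorNorm ℤ ∨ ∃ p : ℕ, p.Prime ∧ p ∣ W.conductorNorm ℤ ∧ p % 3 = 2) :
    ¬ (3 : ℤ) ∣ D.maninConstant := fun h3 => by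
  have hlt := h177 W D hL h9 h81 hrs h3
  rw [h161 W D hL (forall_modularDegree_le_of_latticeOptimal D hL) h9 h81] at hlt
  exact lt_irrefl _ hlt

/-- **C3 on the range, crux currency.**  At a level `N` with `3² ∣ N`, `81 ∤ N` and (`27 ∤ N` or a prime `≡ 2 mod 3` divides `N`), the
Manin constant of every lattice-optimal `X₀(N)`-datum of a globally minimal `W` is prime to `3`, GIVEN E-177 (inline), E-161 and the
modularity binder `exists_isNewformOf` (which pins `N = N_W`, `ModularParametrizationData.level_eq_conductorNorm_of_exists`).  No Kato
input, no Kummer law, no `3`-torsion position law is used on this range.  CONDITIONAL on E-177 and E-161. -/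
theorem not_three_dvd_maninConstant_of_ghostDuality_of_range
    (h177 : ∀ (W : WeierstrassCurve ℚ) [W.IsElliptic] [W.IsGloballyMinimal] [NeZero (W.conductorNorm ℤ)]
      (D : ModularParametrizationData W (W.conductorNorm ℤ)),
      (∀ z ∈ D.L.lattice, ∃ w ∈ periodLattice D.f, z = D.c * w) →
      9 ∣ W.conductorNorm ℤ → ¬ 81 ∣ W.conductorNorm ℤ →
      (¬ 27 ∣ W.conductorNorm ℤ ∨ ∃ p : ℕ, p.Prime ∧ p ∣ W.conductorNorm ℤ ∧ p % 3 = 2) →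
      (3 : ℤ) ∣ D.maninConstant →
        padicValNat 3 (lineIndex (drLatticeAtThree (W.conductorNorm ℤ)) D.f) < padicValNat 3 D.modularDegree)
    (h161 : RedDepthEqModularDegreeAtThree) (hEx : exists_isNewformOf)
    (W : WeierstrassCurve ℚ) [W.IsElliptic] [W.IsGloballyMinimal] {N : ℕ} [NeZero N]
    (D : ModularParametrizationData W N)
    (hL : ∀ z ∈ D.L.lattice, ∃ w ∈ periodLattice D.f, z = D.c * w)
    (h9 : 3 ^ 2 ∣ N) (h81 : ¬ 81 ∣ N) (hrs : ¬ 27 ∣ N ∨ ∃ p : ℕ, p.Prime ∧ p ∣ N ∧ p % 3 = 2) :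
    ¬ (3 : ℤ) ∣ D.maninConstant := by
  have hN : N = W.conductorNorm ℤ := ModularParametrizationData.level_eq_conductorNorm_of_exists hEx D
  subst hN
  have h9' : 9 ∣ W.conductorNorm ℤ := by norm_num at h9; exact h9
  exact not_three_dvd_maninConstant_of_redDefect_of_redDepth_of_latticeOptimal h177 h161 W D hL h9' h81 hrs

/-- **C3 from ghost duality on the range + the residual off it** — the planner-of-record's composition
`GhostDuality.ManinPrimeToThreeAtNine_of` (crux workfile `Lines/ghost_duality.lean`, imc g23) with its transport stub DISCHARGED by
`modularDegree_le_of_latticeOptimal` (p710128): the route declaration `ManinPrimeToThreeAtNine` follows from E-177 (inline), E-161 and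
the residual statement «C3 verbatim at `9 ∣ N` with `81 ∣ N`, or `27 ∣ N` and no prime factor `≡ 2 mod 3`».  CONDITIONAL on all three;
BSD is not proved by this; C3 OPEN. -/
theorem maninPrimeToThreeAtNine_of_ghostDuality
    (h177 : ∀ (W : WeierstrassCurve ℚ) [W.IsElliptic] [W.IsGloballyMinimal] [NeZero (W.conductorNorm ℤ)]
      (D : ModularParametrizationData W (W.conductorNorm ℤ)),
      (∀ z ∈ D.L.lattice, ∃ w ∈ periodLattice D.f, z = D.c * w) →
      9 ∣ W.conductorNorm ℤ → ¬ 81 ∣ W.conductorNorm ℤ →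
      (¬ 27 ∣ W.conductorNorm ℤ ∨ ∃ p : ℕ, p.Prime ∧ p ∣ W.conductorNorm ℤ ∧ p % 3 = 2) →
      (3 : ℤ) ∣ D.maninConstant →
        padicValNat 3 (lineIndex (drLatticeAtThree (W.conductorNorm ℤ)) D.f) < padicValNat 3 D.modularDegree)
    (h161 : RedDepthEqModularDegreeAtThree)
    (hres : Literature.NumberTheory.EllipticCurves.ModularForms.mazur_not_dvd_maninConstant_of_odd →
      Literature.NumberTheory.EllipticCurves.ModularForms.abbesUllmo_not_dvd_maninConstant_of_not_dvd_level →
      Literature.NumberTheory.EllipticCurves.ModularForms.cesnavicius_not_two_dvd_maninConstant_of_two_dvd_level →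
      Literature.NumberTheory.EllipticCurves.ModularForms.exists_isNewformOf →
      ∀ (W : WeierstrassCurve ℚ) [W.IsElliptic] [W.IsGloballyMinimal] {N : ℕ} [NeZero N]
        (D : ModularParametrizationData W N),
        (∀ z ∈ D.L.lattice, ∃ w ∈ periodLattice D.f, z = D.c * w) → 3 ^ 2 ∣ N →
        (81 ∣ N ∨ (27 ∣ N ∧ ∀ p : ℕ, p.Prime → p ∣ N → p % 3 ≠ 2)) →
        ¬ (3 : ℤ) ∣ D.maninConstant) :
    Summit.BirchSwinnertonDyer.BirchSwinnertonDyer.Theses.ManinLocalTwoThree.ManinPrimeToThreeAtNine := by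
  intro hMaz hAU hCes hEx W _ _ N _ D hL h9
  by_cases hrange : ¬ 81 ∣ N ∧ (¬ 27 ∣ N ∨ ∃ p : ℕ, p.Prime ∧ p ∣ N ∧ p % 3 = 2)
  · exact not_three_dvd_maninConstant_of_ghostDuality_of_range h177 h161 hEx W D hL h9 hrange.1 hrange.2
  · refine hres hMaz hAU hCes hEx W D hL h9 ?_
    by_cases h81 : 81 ∣ N
    · exact Or.inl h81
    · refine Or.inr ⟨?_, ?_⟩
      · by_contra h27
        exact hrange ⟨h81, Or.inl h27⟩
      · intro p hp hpN hp3
        exact hrange ⟨h81, Or.inr ⟨p, hp, hpN, hp3⟩⟩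

/-! ## §2 (lead p1 gen 14, 2026-08-29): the same three theorems with E-imc-177 BY NAME
T-imc-35 landed (`Summits/BirchSwinnertonDyer/Rank1Residual/ManinAdditive/NeronOmegaGhostDuality.lean`, p710329): the inline hypothesis
`h177` of §1 is VERBATIM the body of the typed node `NeronOmegaGenus.ThreeDvdManinForcesRedDefectAtThree` (E-imc-177, THEOREM 29.M on paper,
referee audit R-imc-70 PASSED on paper per ref1 §R143), so the ghost road now reads on two NAMED nodes: E-177 and E-161
(`NeronOmegaThree.RedDepthEqModularDegreeAtThree`).  CONDITIONAL on both; BSD is not proved by this; C3 OPEN. -/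

/-- **29.N by name, no degree hypothesis**: E-imc-177 ∧ E-imc-161 ⟹ `3 ∤ c` for every LATTICE-optimal conductor-level datum on the
rational-singularity range (`9 ∣ N`, `81 ∤ N`, `27 ∤ N` or some prime `≡ 2 mod 3` divides `N`).  (= §1 with `h177` named; compare the typer's
`NeronOmegaGenus.not_three_dvd_maninConstant_of_redDefect_of_redDepth`, which still carries the degree-minimality hypothesis.) -/
theorem not_three_dvd_maninConstant_of_ghostDuality_byName
    (h177 : NeronOmegaGenus.ThreeDvdManinForcesRedDefectAtThree) (h161 : RedDepthEqModularDegreeAtThree)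
    (W : WeierstrassCurve ℚ) [W.IsElliptic] [W.IsGloballyMinimal] [NeZero (W.conductorNorm ℤ)]
    (D : ModularParametrizationData W (W.conductorNorm ℤ))
    (hL : ∀ z ∈ D.L.lattice, ∃ w ∈ periodLattice D.f, z = D.c * w)
    (h9 : 9 ∣ W.conductorNorm ℤ) (h81 : ¬ 81 ∣ W.conductorNorm ℤ)
    (hrs : ¬ 27 ∣ W.conductorNorm ℤ ∨ ∃ p : ℕ, p.Prime ∧ p ∣ W.conductorNorm ℤ ∧ p % 3 = 2) :
    ¬ (3 : ℤ) ∣ D.maninConstant :=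
  not_three_dvd_maninConstant_of_redDefect_of_redDepth_of_latticeOptimal h177 h161 W D hL h9 h81 hrs

/-- **C3 on the range in crux currency, by name**: at a level `N` with `3² ∣ N`, `81 ∤ N`, (`27 ∤ N` or a prime `≡ 2 mod 3` divides `N`),
every lattice-optimal `X₀(N)`-datum of a globally minimal `W` has Manin constant prime to `3`, GIVEN E-177, E-161 (both by name) and the
modularity binder `exists_isNewformOf`.  CONDITIONAL. -/
theorem not_three_dvd_maninConstant_of_ghostDuality_of_range_byName
    (h177 : NeronOmegaGenus.ThreeDvdManinForcesRedDefectAtThree) (h161 : RedDepthEqModularDegreeAtThree) (hEx : exists_isNewformOf)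
    (W : WeierstrassCurve ℚ) [W.IsElliptic] [W.IsGloballyMinimal] {N : ℕ} [NeZero N]
    (D : ModularParametrizationData W N)
    (hL : ∀ z ∈ D.L.lattice, ∃ w ∈ periodLattice D.f, z = D.c * w)
    (h9 : 3 ^ 2 ∣ N) (h81 : ¬ 81 ∣ N) (hrs : ¬ 27 ∣ N ∨ ∃ p : ℕ, p.Prime ∧ p ∣ N ∧ p % 3 = 2) :
    ¬ (3 : ℤ) ∣ D.maninConstant :=
  not_three_dvd_maninConstant_of_ghostDuality_of_range h177 h161 hEx W D hL h9 h81 hrs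

/-- **The route declaration from the ghost line, by name**: `ManinPrimeToThreeAtNine` ⟸ E-imc-177 ∧ E-imc-161 ∧ the residual statement
«C3 verbatim at `9 ∣ N` with `81 ∣ N`, or `27 ∣ N` and no prime factor `≡ 2 mod 3`».  CONDITIONAL on all three; BSD is not proved by this;
C3 OPEN. -/
theorem maninPrimeToThreeAtNine_of_ghostDuality_byName
    (h177 : NeronOmegaGenus.ThreeDvdManinForcesRedDefectAtThree) (h161 : RedDepthEqModularDegreeAtThree)
    (hres : Literature.NumberTheory.EllipticCurves.ModularForms.mazur_not_dvd_maninConstant_of_odd →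
      Literature.NumberTheory.EllipticCurves.ModularForms.abbesUllmo_not_dvd_maninConstant_of_not_dvd_level →
      Literature.NumberTheory.EllipticCurves.ModularForms.cesnavicius_not_two_dvd_maninConstant_of_two_dvd_level →
      Literature.NumberTheory.EllipticCurves.ModularForms.exists_isNewformOf →
      ∀ (W : WeierstrassCurve ℚ) [W.IsElliptic] [W.IsGloballyMinimal] {N : ℕ} [NeZero N]
        (D : ModularParametrizationData W N),
        (∀ z ∈ D.L.lattice, ∃ w ∈ periodLattice D.f, z = D.c * w) → 3 ^ 2 ∣ N →
        (81 ∣ N ∨ (27 ∣ N ∧ ∀ p : ℕ, p.Prime → p ∣ N → p % 3 ≠ 2)) →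
        ¬ (3 : ℤ) ∣ D.maninConstant) :
    Summit.BirchSwinnertonDyer.BirchSwinnertonDyer.Theses.ManinLocalTwoThree.ManinPrimeToThreeAtNine :=
  maninPrimeToThreeAtNine_of_ghostDuality h177 h161 hres

end Summit.BirchSwinnertonDyer.BirchSwinnertonDyer.Theorems.ManinLocalTwoThree

end
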